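import Summits.Ventures.HodgeRepro.CosetQuadCore

/-!
# Route-2's Theorem T, sub-case (ii), for a GENERAL modulus — the model `(ℤ/m × ℤ/2) ⋊ ℤ/2` and its transport

Blind re-derivation cell `pub-hodge-repro`, seat `p1` (gen 12).  `TwistedQuadII.lean` put the `k = 3` row of
Theorem T sub-case (ii) (`c ∉ ⟨v⟩`, `u v u⁻¹ = c v^ε`) on the kernel through the decided model of order 24.  This
file builds the model for every even `m = 2k` and every sign: `N = ℤ/m × ℤ/2 = ⟨v⟩ × ⟨c⟩`, the involution
`τ_s (n, e) = (s n, n + e)` for `s ∈ ℤ/m` with `s² = 1` and `s` odd (`s = ±1` are the two signs; `τ_s` sends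
`v ↦ c v^s`, `c ↦ c`), `H = N ⋊ ⟨u⟩` of order `8k`, coordinates `mkII n e g = vⁿ cᵉ uᵍ`, the hom `modelHomII`
into any `(G, c)` with `v^m = 1`, `c² = 1`, `u² = 1`, `u v u⁻¹ = c v^{s.val}`, injective for `v` of order `m`,
`c ∉ ⟨v⟩`, `u ∉ ⟨v, c⟩`, and the transport theorem `exists_twistedRectQuad_ii_of_model`: a decided-or-proved
pattern `Φ₀` on the model gives the twisted rectangle in every ambient `(G, c)`.  The uniform families of CM
types (both signs, every `k ≥ 3`) are the business of `TwistedQuadIINeg` / `TwistedQuadIIPos`.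
-/

set_option autoImplicit false

open Finset Multiplicative
open scoped Pointwise

namespace HodgeRepro.TwistedQuadIIGen

open HodgeRepro.CosetQuad

/-! ### The model group -/

variable (m : ℕ) [NeZero m]

/-- `N = ⟨v⟩ × ⟨c⟩ = ℤ/m × ℤ/2` (multiplicative). -/
abbrev NGen : Type := Multiplicative (ZMod m) × Multiplicative (ZMod 2)

/-- The parity map `ℤ/m → ℤ/2`, `n ↦ n.val mod 2`. -/
def par (n : ZMod m) : ZMod 2 := (n.val : ZMod 2)

omit [NeZero m] in
/-- `((x % m : ℕ) : ℤ/2) = (x : ℤ/2)` for even `m`. -/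
theorem natCast_mod_two (hm : 2 ∣ m) (x : ℕ) : ((x % m : ℕ) : ZMod 2) = (x : ZMod 2) := by
  rw [← ZMod.natCast_mod (x % m) 2, Nat.mod_mod_of_dvd x hm, ZMod.natCast_mod]

/-- The parity map is additive for even `m`. -/
theorem par_add (hm : 2 ∣ m) (a b : ZMod m) : par m (a + b) = par m a + par m b := by
  rw [par, par, par, ZMod.val_add, natCast_mod_two m hm, Nat.cast_add]

omit [NeZero m] in
/-- The parity map respects multiplication by an odd `s`. -/
theorem par_mul_odd (hm : 2 ∣ m) {s : ZMod m} (hodd : s.val % 2 = 1) (a : ZMod m) : par m (s * a) = par m a := by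
  rw [par, par, ZMod.val_mul, natCast_mod_two m hm, ← ZMod.natCast_mod (s.val * a.val) 2, Nat.mul_mod, hodd,
    one_mul, Nat.mod_mod, ZMod.natCast_mod]

omit [NeZero m] in
/-- `x + x = 0` in `ℤ/2`. -/
theorem zmod_two_add_self (x : ZMod 2) : x + x = 0 := by
  rcases (show ∀ y : ZMod 2, y = 0 ∨ y = 1 by decide) x with rfl | rfl <;> decide

variable (hm : 2 ∣ m) (s : ZMod m) (hs : s * s = 1) (hodd : s.val % 2 = 1)

/-- The underlying map of `τ_s`: `(n, e) ↦ (s n, n + e)`. -/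
def tauFun (x : NGen m) : NGen m := (ofAdd (s * toAdd x.1), ofAdd (par m (toAdd x.1) + toAdd x.2))

omit [NeZero m] in
include hm hs hodd in
/-- `τ_s` is an involution. -/
theorem tauFun_tauFun (x : NGen m) : tauFun m s (tauFun m s x) = x := by
  obtain ⟨a, b⟩ := x
  obtain ⟨a, rfl⟩ := ofAdd.surjective a
  obtain ⟨b, rfl⟩ := ofAdd.surjective b
  simp only [tauFun, toAdd_ofAdd, ← mul_assoc, hs, one_mul, par_mul_odd m hm hodd, ← add_assoc,
    zmod_two_add_self, zero_add]

include hm in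
/-- `τ_s` is multiplicative. -/
theorem tauFun_mul (x y : NGen m) : tauFun m s (x * y) = tauFun m s x * tauFun m s y := by
  obtain ⟨a, b⟩ := x
  obtain ⟨a', b'⟩ := y
  obtain ⟨a, rfl⟩ := ofAdd.surjective a
  obtain ⟨b, rfl⟩ := ofAdd.surjective b
  obtain ⟨a', rfl⟩ := ofAdd.surjective a'
  obtain ⟨b', rfl⟩ := ofAdd.surjective b'
  simp only [tauFun, Prod.mk_mul_mk, ← ofAdd_add, toAdd_ofAdd, mul_add, par_add m hm]
  refine Prod.ext rfl ?_
  show ofAdd (par m a + par m a' + (b + b')) = ofAdd (par m a + b + (par m a' + b'))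
  rw [add_add_add_comm]

/-- The involutive automorphism `τ_s` of `N` (`v ↦ c v^s`, `c ↦ c`). -/
def tauII : NGen m ≃* NGen m where
  toFun := tauFun m s
  invFun := tauFun m s
  left_inv := tauFun_tauFun m hm s hs hodd
  right_inv := tauFun_tauFun m hm s hs hodd
  map_mul' := tauFun_mul m hm s

/-- `τ_s` as a function. -/
theorem tauII_apply (x : NGen m) : tauII m hm s hs hodd x = tauFun m s x := rfl

/-- `τ_s² = 1`. -/
theorem tauII_sq : tauII m hm s hs hodd ^ 2 = 1 :=
  MulEquiv.ext (fun x => by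
    show tauII m hm s hs hodd (tauII m hm s hs hodd x) = x
    rw [tauII_apply, tauII_apply, tauFun_tauFun m hm s hs hodd])

/-- The action `ℤ/2 →* Aut(N)`, the generator acting by `τ_s`. -/
def phiII : Multiplicative (ZMod 2) →* MulAut (NGen m) := zmodPowHom 2 (tauII m hm s hs hodd) (tauII_sq m hm s hs hodd)

/-- `phiII` on `0`. -/
theorem phiII_zero : phiII m hm s hs hodd (ofAdd 0) = 1 := by
  rw [phiII, zmodPowHom_apply, toAdd_ofAdd, ZMod.val_zero, pow_zero]

/-- `phiII` on the generator. -/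
theorem phiII_one : phiII m hm s hs hodd (ofAdd 1) = tauII m hm s hs hodd := by
  rw [phiII, zmodPowHom_apply, toAdd_ofAdd, val_one_two, pow_one]

/-- The model group `H = N ⋊ ⟨u⟩` of order `4m`. -/
abbrev HGen : Type := NGen m ⋊[phiII m hm s hs hodd] Multiplicative (ZMod 2)

/-- `(HGen m hm s hs hodd)` is a finite type (through the product of its two coordinates). -/
instance : Fintype (HGen m hm s hs hodd) :=
  Fintype.ofEquiv (NGen m × Multiplicative (ZMod 2))
    { toFun := fun p => ⟨p.1, p.2⟩, invFun := fun x => (x.left, x.right),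
      left_inv := fun _ => rfl, right_inv := fun _ => rfl }

/-- Equality on `(HGen m hm s hs hodd)` is decidable (coordinatewise). -/
instance : DecidableEq (HGen m hm s hs hodd) := fun x y =>
  decidable_of_iff (x.left = y.left ∧ x.right = y.right)
    ⟨fun h => SemidirectProduct.ext h.1 h.2, fun h => ⟨congrArg _ h, congrArg _ h⟩⟩

/-- Coordinates: `mkII n e g = vⁿ cᵉ uᵍ`. -/
def mkII (n : ZMod m) (e g : ZMod 2) : HGen m hm s hs hodd := ⟨(ofAdd n, ofAdd e), ofAdd g⟩

/-- `v = mkII 1 0 0`. -/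
def vII : HGen m hm s hs hodd := mkII m hm s hs hodd 1 0 0

/-- `c = mkII 0 1 0`, the central involution outside `⟨v⟩`. -/
def cII : HGen m hm s hs hodd := mkII m hm s hs hodd 0 1 0

/-- `u = mkII 0 0 1`. -/
def uII : HGen m hm s hs hodd := mkII m hm s hs hodd 0 0 1

/-- The twisted rectangle `{1, u, v, v u}`. -/
def rectTII : Fin 4 → HGen m hm s hs hodd :=
  ![1, uII m hm s hs hodd, vII m hm s hs hodd, vII m hm s hs hodd * uII m hm s hs hodd]

/-! ### Transport -/

variable {G : Type*} [Group G]

/-- The hom `N →* G`, `(n, e) ↦ vⁿ cᵉ`, for `v^m = 1`, `c² = 1`, `v c = c v`. -/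
def nHom (v c : G) (hv : v ^ m = 1) (hc2 : c ^ 2 = 1) (hvc : v * c = c * v) : NGen m →* G :=
  (zmodPowHom m v hv).noncommCoprod (zmodPowHom 2 c hc2) (fun _ _ => Commute.pow_pow (hvc : Commute v c) _ _)

/-- `nHom (n, e) = vⁿ cᵉ`. -/
theorem nHom_apply (v c : G) (hv : v ^ m = 1) (hc2 : c ^ 2 = 1) (hvc : v * c = c * v) (n : ZMod m)
    (e : ZMod 2) : nHom m v c hv hc2 hvc (ofAdd n, ofAdd e) = v ^ n.val * c ^ e.val := by
  rw [nHom, MonoidHom.noncommCoprod_apply, zmodPowHom_apply, zmodPowHom_apply, toAdd_ofAdd, toAdd_ofAdd]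

/-- Every element of `N` is `(v, 1)ⁿ (1, c)ᵉ`. -/
theorem NGen_decomp (x : NGen m) :
    x = (ofAdd 1, 1) ^ (toAdd x.1).val * (1, ofAdd 1) ^ (toAdd x.2).val := by
  obtain ⟨a, b⟩ := x
  obtain ⟨a, rfl⟩ := ofAdd.surjective a
  obtain ⟨b, rfl⟩ := ofAdd.surjective b
  simp only [Prod.pow_mk, Prod.mk_mul_mk, one_pow, mul_one, one_mul, toAdd_ofAdd, ← ofAdd_nsmul, nsmul_eq_mul,
    mul_one, ZMod.natCast_zmod_val]

/-- `τ_s` on the two generators (`m > 1`). -/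
theorem tauII_gen (hm1 : 1 < m) :
    tauII m hm s hs hodd (ofAdd 1, 1) = (ofAdd s, ofAdd 1) ∧ tauII m hm s hs hodd (1, ofAdd 1) = (1, ofAdd 1) := by
  haveI : Fact (1 < m) := ⟨hm1⟩
  constructor
  · show (ofAdd (s * toAdd (ofAdd 1)), ofAdd (par m (toAdd (ofAdd (1 : ZMod m))) + toAdd (1 : Multiplicative (ZMod 2)))) =
      (ofAdd s, ofAdd 1)
    rw [toAdd_ofAdd, mul_one, toAdd_one, add_zero, par, ZMod.val_one, Nat.cast_one]
  · show (ofAdd (s * toAdd (1 : Multiplicative (ZMod m))), ofAdd (par m (toAdd (1 : Multiplicative (ZMod m))) + toAdd (ofAdd 1))) =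
      (1, ofAdd 1)
    rw [toAdd_one, mul_zero, ofAdd_zero, par, ZMod.val_zero, Nat.cast_zero, zero_add, toAdd_ofAdd]

/-- The compatibility of `nHom` with `τ_s` on the generators. -/
theorem nHom_tau_gen (hm1 : 1 < m) (v c u : G) (hv : v ^ m = 1) (hc2 : c ^ 2 = 1) (hvc : v * c = c * v)
    (huv : u * v * u⁻¹ = c * v ^ s.val) (huc : u * c * u⁻¹ = c) :
    nHom m v c hv hc2 hvc (tauII m hm s hs hodd (ofAdd 1, 1)) = u * nHom m v c hv hc2 hvc (ofAdd 1, 1) * u⁻¹ ∧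
    nHom m v c hv hc2 hvc (tauII m hm s hs hodd (1, ofAdd 1)) = u * nHom m v c hv hc2 hvc (1, ofAdd 1) * u⁻¹ := by
  haveI : Fact (1 < m) := ⟨hm1⟩
  have e1 : ((ofAdd 1, 1) : NGen m) = (ofAdd 1, ofAdd 0) := rfl
  have e2 : ((1, ofAdd 1) : NGen m) = (ofAdd 0, ofAdd 1) := rfl
  obtain ⟨t1, t2⟩ := tauII_gen m hm s hs hodd hm1
  constructor
  · rw [t1, e1, nHom_apply, nHom_apply, ZMod.val_one m, ZMod.val_zero, val_one_two, pow_one, pow_zero, mul_one,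
      pow_one, huv]
    exact ((Commute.pow_right (hvc : Commute v c).symm _)).eq.symm
  · rw [t2, e2, nHom_apply, ZMod.val_zero, val_one_two, pow_zero, pow_one, one_mul, huc]

/-- The compatibility of `nHom` with `τ_s`: `nHom (τ x) = u · nHom x · u⁻¹`. -/
theorem nHom_compat (hm1 : 1 < m) (v c u : G) (hv : v ^ m = 1) (hc2 : c ^ 2 = 1) (hvc : v * c = c * v)
    (hu : u ^ 2 = 1) (huv : u * v * u⁻¹ = c * v ^ s.val) (huc : u * c * u⁻¹ = c) (g : Multiplicative (ZMod 2)) :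
    (nHom m v c hv hc2 hvc).comp (MulEquiv.toMonoidHom (phiII m hm s hs hodd g)) =
      (MulEquiv.toMonoidHom (MulAut.conj (zmodPowHom 2 u hu g))).comp (nHom m v c hv hc2 hvc) := by
  obtain ⟨gv, gc⟩ := nHom_tau_gen m hm s hs hodd hm1 v c u hv hc2 hvc huv huc
  obtain ⟨g, rfl⟩ := ofAdd.surjective g
  refine MonoidHom.ext (fun x => ?_)
  rw [MonoidHom.comp_apply, MonoidHom.comp_apply, MulEquiv.coe_toMonoidHom, MulEquiv.coe_toMonoidHom,
    zmodPowHom_apply, toAdd_ofAdd, MulAut.conj_apply]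
  rcases (show g = 0 ∨ g = 1 by revert g; decide) with rfl | rfl
  · rw [phiII_zero, MulAut.one_apply, ZMod.val_zero, pow_zero, one_mul, inv_one, mul_one]
  · rw [phiII_one, val_one_two, pow_one, NGen_decomp m x]
    simp only [map_mul, map_pow]
    rw [gv, gc, conj_pow, conj_pow, conj_mul]

/-- The model hom `H →* G`, `vⁿ cᵉ uᵍ ↦ vⁿ cᵉ uᵍ`. -/
def modelHomII (hm1 : 1 < m) (v c u : G) (hv : v ^ m = 1) (hc2 : c ^ 2 = 1) (hvc : v * c = c * v) (hu : u ^ 2 = 1)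
    (huv : u * v * u⁻¹ = c * v ^ s.val) (huc : u * c * u⁻¹ = c) : HGen m hm s hs hodd →* G :=
  SemidirectProduct.lift (nHom m v c hv hc2 hvc) (zmodPowHom 2 u hu)
    (nHom_compat m hm s hs hodd hm1 v c u hv hc2 hvc hu huv huc)

/-- `modelHomII` in coordinates. -/
theorem modelHomII_mk (hm1 : 1 < m) (v c u : G) (hv : v ^ m = 1) (hc2 : c ^ 2 = 1) (hvc : v * c = c * v)
    (hu : u ^ 2 = 1) (huv : u * v * u⁻¹ = c * v ^ s.val) (huc : u * c * u⁻¹ = c) (n : ZMod m) (e g : ZMod 2) :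
    modelHomII m hm s hs hodd hm1 v c u hv hc2 hvc hu huv huc (mkII m hm s hs hodd n e g) =
      v ^ n.val * c ^ e.val * u ^ g.val := by
  rw [mkII, SemidirectProduct.mk_eq_inl_mul_inr, map_mul, modelHomII, SemidirectProduct.lift_inl,
    SemidirectProduct.lift_inr, nHom_apply, zmodPowHom_apply, toAdd_ofAdd]

/-- The images of `v`, `c`, `u`. -/
theorem modelHomII_gen (hm1 : 1 < m) (v c u : G) (hv : v ^ m = 1) (hc2 : c ^ 2 = 1) (hvc : v * c = c * v)
    (hu : u ^ 2 = 1) (huv : u * v * u⁻¹ = c * v ^ s.val) (huc : u * c * u⁻¹ = c) :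
    modelHomII m hm s hs hodd hm1 v c u hv hc2 hvc hu huv huc (vII m hm s hs hodd) = v ∧
    modelHomII m hm s hs hodd hm1 v c u hv hc2 hvc hu huv huc (cII m hm s hs hodd) = c ∧
    modelHomII m hm s hs hodd hm1 v c u hv hc2 hvc hu huv huc (uII m hm s hs hodd) = u := by
  haveI : Fact (1 < m) := ⟨hm1⟩
  refine ⟨?_, ?_, ?_⟩
  · rw [vII, modelHomII_mk, ZMod.val_one m]
    simp only [ZMod.val_zero, pow_one, pow_zero, mul_one]
  · rw [cII, modelHomII_mk]
    simp only [ZMod.val_zero, val_one_two, pow_zero, pow_one, one_mul, mul_one]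
  · rw [uII, modelHomII_mk]
    simp only [ZMod.val_zero, val_one_two, pow_zero, pow_one, one_mul]

/-- The twists `![1, u, v, v u]` are the images of `rectTII`. -/
theorem modelHomII_rectTII (hm1 : 1 < m) (v c u : G) (hv : v ^ m = 1) (hc2 : c ^ 2 = 1) (hvc : v * c = c * v)
    (hu : u ^ 2 = 1) (huv : u * v * u⁻¹ = c * v ^ s.val) (huc : u * c * u⁻¹ = c) (i : Fin 4) :
    modelHomII m hm s hs hodd hm1 v c u hv hc2 hvc hu huv huc (rectTII m hm s hs hodd i) = ![1, u, v, v * u] i := by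
  obtain ⟨gv, _, gu⟩ := modelHomII_gen m hm s hs hodd hm1 v c u hv hc2 hvc hu huv huc
  fin_cases i
  · exact map_one _
  · exact gu
  · exact gv
  · show modelHomII m hm s hs hodd hm1 v c u hv hc2 hvc hu huv huc (vII m hm s hs hodd * uII m hm s hs hodd) = v * u
    rw [map_mul, gv, gu]

/-- `modelHomII` is injective for `v` of order `m`, `c ∉ ⟨v⟩`, `u ∉ ⟨v, c⟩`. -/
theorem modelHomII_injective (hm1 : 1 < m) (v c u : G) (hv : v ^ m = 1) (hc2 : c ^ 2 = 1) (hvc : v * c = c * v)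
    (hu : u ^ 2 = 1) (huv : u * v * u⁻¹ = c * v ^ s.val) (huc : u * c * u⁻¹ = c) (hvm : orderOf v = m)
    (hcv : c ∉ Subgroup.zpowers v) (hunot : u ∉ Subgroup.closure ({v, c} : Set G)) :
    Function.Injective (modelHomII m hm s hs hodd hm1 v c u hv hc2 hvc hu huv huc) := by
  have hZ2 : ∀ y : ZMod 2, y = 0 ∨ y = 1 := by decide
  rw [injective_iff_map_eq_one]
  rintro ⟨⟨n, e⟩, g⟩ h
  obtain ⟨n, rfl⟩ := ofAdd.surjective n
  obtain ⟨e, rfl⟩ := ofAdd.surjective e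
  obtain ⟨g, rfl⟩ := ofAdd.surjective g
  change modelHomII m hm s hs hodd hm1 v c u hv hc2 hvc hu huv huc (mkII m hm s hs hodd n e g) = 1 at h
  rw [modelHomII_mk] at h
  have hvmem : v ∈ Subgroup.closure ({v, c} : Set G) := Subgroup.subset_closure (by simp)
  have hcmem : c ∈ Subgroup.closure ({v, c} : Set G) := Subgroup.subset_closure (by simp)
  rcases hZ2 g with rfl | rfl
  · rw [ZMod.val_zero, pow_zero, mul_one] at h
    rcases hZ2 e with rfl | rfl
    · rw [ZMod.val_zero, pow_zero, mul_one] at h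
      have hdvd : m ∣ n.val := by
        have hd := orderOf_dvd_of_pow_eq_one h
        rwa [hvm] at hd
      have hn0 : n.val = 0 := Nat.eq_zero_of_dvd_of_lt hdvd (ZMod.val_lt _)
      have hn : n = 0 := (ZMod.val_eq_zero _).mp hn0
      rw [hn]
      rfl
    · exfalso
      apply hcv
      rw [val_one_two, pow_one] at h
      rw [← inv_eq_of_mul_eq_one_right h]
      exact Subgroup.inv_mem _ (Subgroup.npow_mem_zpowers v _)
  · exfalso
    apply hunot
    rw [val_one_two, pow_one] at h
    rw [← inv_eq_of_mul_eq_one_right h]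
    exact Subgroup.inv_mem _ (Subgroup.mul_mem _ (Subgroup.pow_mem _ hvmem _) (Subgroup.pow_mem _ hcmem _))

/-- **Transport for sub-case (ii)**: a pattern `Φ₀` on the model (CM for `c`, SumTwo on the rectangle, no conjugate
pair) gives the twisted rectangle in every finite `(G, c)` with `v` of order `m`, `c ∉ ⟨v⟩`, an involution
`u ∉ ⟨v, c⟩` and `u v u⁻¹ = c v^{s.val}`. -/
theorem exists_twistedRectQuad_ii_of_model [Fintype G] [DecidableEq G] (hm1 : 1 < m) {c : G} (hc : IsComplexConj c)
    (v u : G) (hvm : orderOf v = m) (hu : u ^ 2 = 1) (huv : u * v * u⁻¹ = c * v ^ s.val)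
    (hcv : c ∉ Subgroup.zpowers v) (hunot : u ∉ Subgroup.closure ({v, c} : Set G))
    (Φ₀ : Finset (HGen m hm s hs hodd))
    (h1 : ∀ p, decide (p * cII m hm s hs hodd ∈ Φ₀) = !decide (p ∈ Φ₀))
    (h2 : ∀ p, (univ.filter fun i : Fin 4 => decide (p * (rectTII m hm s hs hodd i)⁻¹ ∈ Φ₀) = true).card = 2)
    (h3 : ∀ i j : Fin 4, ¬ ∀ p, (decide (p * (rectTII m hm s hs hodd j)⁻¹ ∈ Φ₀) = true ↔
      decide (p * (cII m hm s hs hodd * (rectTII m hm s hs hodd i)⁻¹) ∈ Φ₀) = true)) :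
    ∃ Φ : Finset G, IsCMType c Φ ∧ SumTwo (fun i => rmul Φ (![1, u, v, v * u] i)) ∧
      ∀ i j : Fin 4, rmul Φ (![1, u, v, v * u] j) ≠ c • rmul Φ (![1, u, v, v * u] i) := by
  have hv : v ^ m = 1 := by rw [← hvm]; exact pow_orderOf_eq_one v
  have hc2 : c ^ 2 = 1 := conj_sq_eq_one hc
  have hvc : v * c = c * v := (hc.comm v).symm
  have huc : u * c * u⁻¹ = c := by rw [← hc.comm u, mul_assoc, mul_inv_cancel, mul_one]
  have hψ := modelHomII_injective m hm s hs hodd hm1 v c u hv hc2 hvc hu huv huc hvm hcv hunot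
  have hcard : Fintype.card (Fin 1) * Fintype.card (HGen m hm s hs hodd) ≤ Fintype.card G := by
    rw [Fintype.card_fin, one_mul]
    exact Fintype.card_le_of_injective _ hψ
  obtain ⟨Φ, g1, g2, g3⟩ := exists_quad_of_pattern (modelHomII m hm s hs hodd hm1 v c u hv hc2 hvc hu huv huc) hψ hc
    (modelHomII_gen m hm s hs hodd hm1 v c u hv hc2 hvc hu huv huc).2.1 (rectTII m hm s hs hodd)
    (fun (_ : Fin 1) p => decide (p ∈ Φ₀)) (fun _ p => h1 p) (fun _ p => h2 p)
    (fun i j h => h3 i j (fun p => h 0 p)) hcard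
  simp only [modelHomII_rectTII m hm s hs hodd hm1 v c u hv hc2 hvc hu huv huc] at g2 g3
  exact ⟨Φ, g1, g2, g3⟩

end HodgeRepro.TwistedQuadIIGen
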